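import Summits.NavierStokesRegularity.NavierStokesRegularity.Theorems.HeredityFromTwo.Negative.GlobalDesigns
import Summits.NavierStokesRegularity.NavierStokesRegularity.Theorems.PalasekTowerBreakdownNoSwirlSliceLever

/-!
# The SLICE-form no-swirl lever against the CHILD ALONE — `HeredityFrom k₀` (any `k₀ ≥ 1`), in
# particular item 19250 `HeredityFromTwo`: kernel, fact-free, no cap, no sign condition

Cell `ns-blowup`, seat `ns-blowup-refuter5` (g0), K-row K5-11 R1. NEGATIVE-LANE support for the route
item `PalasekTowerBreakdown.HeredityFromTwo` (`:= HeredityFrom 2`, stmt-NavierStokesRegularity-19250).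
LABEL: kernel bookkeeping; no stage, design or flow is constructed; the premise class (a registered
stage at a level `k₀ ≥ 1` whose readout slice is axisymmetric swirl-free) is empty-in-practice (K61 /
S-RING-1 / P-RING-0…2 CLOSED). WHAT THIS IS NOT: not Navier–Stokes evidence either way.

ns-blowup-lean g9's `Realisation.not_noSwirl_slice_of_force_zero` (p456896) empties, GIVEN the PARENT
crux `EpisodeInduction = HeredityFrom 1`, the class of registered stages at a level `k ≥ 1` whose
`τ_k`-slice is axisymmetric without swirl, and hence breaks the PAIR `HeredityAtOne ∧ HeredityFromTwo`;
its docstring records that the child ALONE «needs a `Realisation` constructor with identified fields».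
That constructor is ALREADY in the tree — refuter g12's KJ-11 `Schedule.exists_realisation_of_nonempty_stages`
(`W.f = S.f ∧ W.u 0 = S.u₀ ∧ W.T = S.T`) together with `HeredityFrom.nonempty_stage_all` (one registered
level-`k₀` stage + `HeredityFrom k₀` ⇒ a registered stage at EVERY level, down by
`Stage.restrictOfAntitone`, up by the hand-over). Composing the two with g9's lever and the forced
uniqueness `palasekTowerBreakdown_stage_velocity_eq_solution_rates` gives the slice form at EVERY
starting level `k₀ ≥ 1`:

* `HeredityFrom.no_noSwirl_slice` — under `HeredityFrom k₀` (`k₀ ≥ 1`), NO registered level-`k₀` stage of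
  a pinned (`Λ = 8`, `θ = 6/5`) rigid quiet wide design has an axisymmetric swirl-free readout slice
  `s.u (τ k₀)` (the preparation force on `[0, τ₁)` is unrestricted);
* `not_heredityFrom_of_noSwirl_slice` — packaged: ONE such stage refutes `HeredityFrom k₀`;
* `PalasekTowerBreakdownNegative.palasekTowerBreakdown_not_heredityFromTwo_of_noSwirl_slice` — the route
  decl BY NAME: one such stage at a level `k₀ ≥ 2` refutes item 19250 ALONE (via `HeredityFrom.mono`);
  `…_heredityFromTwo_no_noSwirl_slice` — the contrapositive reading under the item.

At `k₀ = 1` this is g9's parent statement again; item 19249 `HeredityAtOne` ALONE is untouched (one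
hand-over still needs the quantitative Gallay–Šverák cap).

References: P. G. Lemarié-Rieusset, *The Navier–Stokes Problem in the 21st Century* (2016), Thm. 10.4
[cite: LemarieRieusset2016, Thm. 10.4 (p. 285)]; S. Palasek, arXiv:2605.13827 §4
[cite: Palasek2026ElementaryModel, §4].
-/

noncomputable section

namespace Summit.NavierStokesRegularity.FluidComputer.PalasekTowerClayBridge

open Set MeasureTheory
open scoped ENNReal
open Literature.Analysis.FluidPDE
open Summit.NavierStokesRegularity.NavierStokesRegularity.Theorems

section Lever

variable {S : Schedule TowerRates.wide}

/-- **`HeredityFrom k₀` FORBIDS AN AXISYMMETRIC SWIRL-FREE READOUT SLICE at level `k₀ ≥ 1`** (kernel, no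
named fact, no cap, no sign condition, preparation force unrestricted): given `HeredityFrom k₀` and a
registered level-`k₀` stage `s` of a pinned rigid quiet wide design, the slice `s.u (τ k₀)` is not
axisymmetric without swirl. Proof: the design reaches every level (`HeredityFrom.nonempty_stage_all`),
so it realises the tower WITH ITS OWN DESIGN (`Schedule.exists_realisation_of_nonempty_stages`); the
stage IS the realisation's flow on `[0, τ k₀]` (forced uniqueness), and the force vanishes from
`τ₁ ≤ τ k₀` on, so `Realisation.not_noSwirl_slice_of_force_zero` applies.
[cite: LemarieRieusset2016, Thm. 10.4 (p. 285)] -/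
theorem HeredityFrom.no_noSwirl_slice {k₀ : ℕ} (h : HeredityFrom k₀) (hP : S.Pins 8 (6 / 5))
    (hR : S.Rigid) (hQ : S.Quiet) (hk₀ : 1 ≤ k₀)
    (s : Stage 1 TowerRates.wide S (Margins.routeG TowerRates.wide) k₀) :
    ¬ (IsAxisymmetric (s.u (S.τ k₀)) ∧ HasNoSwirl (s.u (S.τ k₀))) := by
  rintro ⟨hA, hS⟩
  obtain ⟨W, hWf, hW0, hWT⟩ :=
    S.exists_realisation_of_nonempty_stages one_pos (h.nonempty_stage_all hP hR hQ s)
  -- the stage is the realisation's flow on `[0, τ k₀]`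
  have hτT : S.τ k₀ < W.T := by rw [hWT]; exact S.τ_lt_T k₀
  set T' : ℝ := (S.τ k₀ + W.T) / 2 with hT'def
  have hT'0 : 0 < T' := by rw [hT'def]; linarith [S.τ_pos k₀]
  have hT'T : T' < W.T := by rw [hT'def]; linarith
  have hτT' : S.τ k₀ ≤ T' := by rw [hT'def]; linarith
  have hU : IsClassicalNSSolutionOn (Icc 0 T') 1 S.f W.u W.p := by
    rw [← hWf]
    exact W.classical_Icc hT'0 hT'T
  have heq : s.u (S.τ k₀) = W.u (S.τ k₀) :=
    palasekTowerBreakdown_stage_velocity_eq_solution_rates one_pos s hτT' hU hW0 (W.energy T' hT'T)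
      (S.τ k₀) ⟨(S.τ_pos k₀).le, le_rfl⟩
  -- quiet era: the force vanishes on `[τ k₀, ∞) ⊆ [τ 1, ∞)`
  have hf : ∀ t : ℝ, S.τ k₀ ≤ t → W.f t = 0 := fun t ht => by
    rw [hWf]
    exact hQ t ((S.τ_mono hk₀).trans ht)
  refine W.not_noSwirl_slice_of_force_zero one_pos ⟨(S.τ_pos k₀).le, hτT⟩ hf ?_ ?_
  · rw [← heq]; exact hA
  · rw [← heq]; exact hS

/-- **The slice-form no-swirl lever at starting level `k₀ ≥ 1`, packaged**: ONE registered level-`k₀`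
stage of a pinned rigid quiet wide design with an axisymmetric swirl-free readout slice refutes
`HeredityFrom k₀`. Premise empty-in-practice. [cite: LemarieRieusset2016, Thm. 10.4 (p. 285)] -/
theorem not_heredityFrom_of_noSwirl_slice {k₀ : ℕ} (hk₀ : 1 ≤ k₀)
    (hW : ∃ (S : Schedule TowerRates.wide)
      (s : Stage 1 TowerRates.wide S (Margins.routeG TowerRates.wide) k₀),
      S.Pins 8 (6 / 5) ∧ S.Rigid ∧ S.Quiet ∧
        IsAxisymmetric (s.u (S.τ k₀)) ∧ HasNoSwirl (s.u (S.τ k₀))) :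
    ¬ HeredityFrom k₀ := by
  rintro h
  obtain ⟨S, s, hP, hR, hQ, hA, hS⟩ := hW
  exact h.no_noSwirl_slice hP hR hQ hk₀ s ⟨hA, hS⟩

end Lever

end Summit.NavierStokesRegularity.FluidComputer.PalasekTowerClayBridge

namespace Summit.NavierStokesRegularity.PalasekTowerBreakdownNegative

open Set
open Summit.NavierStokesRegularity.NavierStokesRegularity.Theses
open Summit.NavierStokesRegularity.FluidComputer.PalasekTowerClayBridge
open Literature.Analysis.FluidPDE

/-- **Item 19250 `PalasekTowerBreakdown.HeredityFromTwo` ALONE is refuted by ONE registered stage at a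
level `k₀ ≥ 2` of a pinned rigid quiet wide design whose readout slice `s.u (τ k₀)` is axisymmetric
without swirl** — route decl by name; kernel, no named fact, no cap, no sign condition, preparation
force unrestricted (body: `HeredityFrom.mono` + `HeredityFrom.no_noSwirl_slice`). Premise
empty-in-practice (K61 / S-RING-1 / P-RING CLOSED). [cite: LemarieRieusset2016, Thm. 10.4 (p. 285)] -/
theorem palasekTowerBreakdown_not_heredityFromTwo_of_noSwirl_slice
    (hW : ∃ (S : Schedule TowerRates.wide) (k₀ : ℕ)
      (s : Stage 1 TowerRates.wide S (Margins.routeG TowerRates.wide) k₀),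
      2 ≤ k₀ ∧ S.Pins 8 (6 / 5) ∧ S.Rigid ∧ S.Quiet ∧
        IsAxisymmetric (s.u (S.τ k₀)) ∧ HasNoSwirl (s.u (S.τ k₀))) :
    ¬ PalasekTowerBreakdown.HeredityFromTwo := by
  rintro hH
  obtain ⟨S, k₀, s, hk₀, hP, hR, hQ, hA, hS⟩ := hW
  exact (HeredityFrom.mono hH hk₀).no_noSwirl_slice hP hR hQ (le_trans (by norm_num) hk₀) s ⟨hA, hS⟩

/-- **Under item 19250 NO registered stage at a level `k ≥ 2` has an axisymmetric swirl-free readout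
slice** (contrapositive reading). [cite: LemarieRieusset2016, Thm. 10.4 (p. 285)] -/
theorem palasekTowerBreakdown_heredityFromTwo_no_noSwirl_slice
    (hH : PalasekTowerBreakdown.HeredityFromTwo) {S : Schedule TowerRates.wide}
    (hP : S.Pins 8 (6 / 5)) (hR : S.Rigid) (hQ : S.Quiet) {k : ℕ} (hk : 2 ≤ k)
    (s : Stage 1 TowerRates.wide S (Margins.routeG TowerRates.wide) k) :
    ¬ (IsAxisymmetric (s.u (S.τ k)) ∧ HasNoSwirl (s.u (S.τ k))) :=
  (HeredityFrom.mono hH hk).no_noSwirl_slice hP hR hQ (le_trans (by norm_num) hk) s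

end Summit.NavierStokesRegularity.PalasekTowerBreakdownNegative

end
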